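import Summits.SmoothPoincare4.SmoothPoincare4.Theses.CyclicSymmetryRung
import Literature.Topology.FourManifolds.HomotopyS4CompactProofs
import HarnessLib
import HarnessLib.Audit

/-!
# Birth skeleton (BC3) for crux `CyclicSymmetryRung.SymInfty` (item stmt-SmoothPoincare4-5979)

Line `birth` — the ENGINE SPLIT of `SymInfty` along the route's own two-layer plan
("SymInfty ⇐ SymInftyBounded → SymInftyUnbounded → SymInfty", route file TWO-LAYER PLAN), typed over the
route file + Mathlib only.

`SymInfty` (the crux, verbatim the route decl
`Summit.SmoothPoincare4.SmoothPoincare4.Theses.CyclicSymmetryRung.SymInfty`): a smooth homotopy 4-sphere `M`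
(bare binders of `SmoothPoincare4`) admitting, for every `n`, a self-diffeomorphism `f` of some prime order
`p ≥ n` (`f^[p] = id`, `f ≠ id`) is diffeomorphic to `S⁴`.

The three registered stubs:

* STUB 1 `stub_fintushelPao : FintushelPao` — the route's crux #2 BY NAME (stmt-SmoothPoincare4-5977; the named
  fact `Literature.Barriers.SmoothPoincare4.fintushelPao_circleAction_homotopySphere_four` over Mathlib vocabulary:
  a closed smooth homotopy 4-sphere with a smooth effective circle action is `S⁴`; Fintushel 1977/78, Pao 1978,
  + Perelman; Edmonds' Problem 27). Mathematically settled, formally XL. NOT the crux: it needs a CIRCLE action.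
* STUB 2 `stub_symExt : SymExt` — the route's ENGINE crux #3 BY NAME (stmt-SmoothPoincare4-5978; quantified
  Fintushel–Pao in extrinsic form: in a fixed `ℝ^N`, homotopy 4-spheres of reach `≥ τ` in the ball `B_R` with a
  linear cyclic symmetry of prime order `p ≥ p₀(N, τ, R)` carry a smooth effective circle action). Size L
  (reach-compactness, Hausdorff limits of cyclic subgroups of `O(N)`, `C¹` averaging, Palais, Whitney). NOT the
  crux: its conclusion is a circle action, and only for symmetries realised linearly in BOUNDED geometry.
* STUB 3 `stub_uniformGeometry` — UNIFORM GEOMETRY (the new, load-bearing, open piece; = the two-layer plan's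
  "unbounded case does not occur"): if a smooth homotopy 4-sphere `M` admits self-diffeomorphisms of unboundedly
  many prime orders, then there is ONE extrinsic geometry class `(N, τ, R)` in which `M` carries, for unboundedly
  many primes `p`, a smooth embedding `e : M → ℝ^N` into `B_R` of reach `≥ τ` invariant under a linear isometry
  `A` inducing order exactly `p` on `e(M)` (verbatim the inner hypothesis of the route's support item
  `LargeSymmetryStandard`). The symmetries realised need not be the given ones (existential form: true on the
  standard `S⁴ ⊂ ℝ⁵` by rotations with `N = 5`, `R = 1`, any `τ < 1`, so the stub is a consequence of
  `SmoothPoincare4` and is refutable only together with it). Why it might fail: an exotic `Σ` whose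
  `ℤ/p`-symmetries exist for infinitely many `p` only with degenerating distortion `R/τ → ∞`
  (cf. exotic tori `Tⁿ # Σⁿ`, disc-sym `= n`, tor-sym `= 0`, Mundet i Riera 2024 Thm 1.7). First lemma toward it:
  Mostow–Palais equivariant embedding of each single `(M, f_p)` in an orthogonal representation (known).

COMPOSITION (kernel-checked, no `sorry` outside the three stubs): `symInfty_of_stubs : FintushelPao → SymExt →
<stub₃-sig> → <the crux statement, unfolded>` — given `M`, `e : M ≃ₕ S⁴` and the symmetries, STUB 3 yields
`(N, τ, R)`; STUB 2 yields `p₀(N, τ, R)`; STUB 3 at `n := p₀` yields a prime `p ≥ p₀` with a bounded-geometry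
linear realisation `(e, A)`; `M` is compact (tree theorem
`Literature.Topology.FourManifolds.compactSpace_of_homotopyEquiv_sphere_four_holds`, Hatcher Prop. 3.29 — no
`CompactSpace` binder is smuggled into the crux); STUB 2 gives a smooth effective circle action on `M`; STUB 1
returns the diffeomorphism `M ≃ₘ S⁴`. THE skeleton theorem `SymInfty_of : CyclicSymmetryRung.SymInfty :=
symInfty_of_stubs stub_fintushelPao stub_symExt stub_uniformGeometry` concludes the crux BY NAME and is
deliberately the ONLY theorem of the file whose conclusion is the crux constant; the arrow form
`<stub₁-sig> → <stub₂-sig> → <stub₃-sig> → SymInfty` is certified by the closing `example`.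

DISPROOF USED: none exists — `ledger crux ls stmt-SmoothPoincare4-5979` shows no `Disproof.lean`, no `Lines/*`,
no landed `Negative/` lemma (2026-08-17); `ledger negatives --problem SmoothPoincare4`: 0 refuted statements.
Refuter route-review evidence on the item (2026-08-15): the crux elaborates, survives the S/¬S battery, and has
NO `CompactSpace` binder by design — honoured: compactness is DERIVED in the composition, and STUB 3 keeps the
crux's exact hypotheses (`Nonempty (M ≃ₕ S⁴)`, the prime-order symmetries), so it is not vacuous by an empty or
non-compact carrier.

BARRIERS: `Literature.Barriers.SmoothPoincare4.CircleActionBarrierFour` is STUB 1 itself (extended, not evaded: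
nothing exotic is built with symmetry); `ProjectiveRigidityBarrierFour` (fake `ℝℙ⁴`: exotic free involutions act
on the STANDARD `S⁴`) does not bite — every conclusion is "`M ≅ S⁴`", never "the action is linear", and STUB 3
asks for SOME linear bounded-geometry symmetries, not for linearisability of the given ones (Pao's non-linear
circle actions on the true `S⁴` restricted to `ℤ/p` are consistent with all three stubs).
-/

-- `Summit.<Summit>.<Problem>`: single-conjunct summit, the duplicate component is mandated (CONVENTIONS §2).
set_option linter.dupNamespace false
set_option linter.unusedVariables false

noncomputable section

open scoped Manifold ContDiff Topology ContinuousMap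
open Summit.SmoothPoincare4.SmoothPoincare4.Theses.CyclicSymmetryRung

namespace Summit.SmoothPoincare4.SmoothPoincare4.Cruxes.SymInfty.Birth

/-! ## The three registered stubs -/

/-- **STUB 1 `stub_fintushelPao` — Fintushel–Pao (route crux #2, stmt-SmoothPoincare4-5977, BY NAME).** A closed
smooth 4-manifold `M ≃ₕ S⁴` with a smooth effective action of the circle group is diffeomorphic to `S⁴`.
Mathematically settled (Fintushel 1977/78 + Pao 1978 + Perelman; smooth reading: Edmonds 2009, Problem 27);
formal delivery XL. [Fintushel1978] [Pao1978] [Edmonds2009Survey] -/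
theorem stub_fintushelPao : FintushelPao := by
  sorry

/-- **STUB 2 `stub_symExt` — the extrinsic symmetry-extension engine (route crux #3, stmt-SmoothPoincare4-5978,
BY NAME).** For all `N`, `τ > 0`, `R` there is `p₀` such that a closed smooth homotopy 4-sphere smoothly embedded in
`B_R ⊂ ℝ^N` with reach `≥ τ`, invariantly under a linear isometry `A` inducing prime order `p ≥ p₀` on the image,
carries a smooth effective circle action. Size L (Federer reach-compactness, Hausdorff limits of cyclic subgroups
of `O(N)`, `C¹` averaging, Palais `C¹ → C^∞`, Whitney). [Federer1959] [Palais1970] [GroveKarcher1973] -/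
theorem stub_symExt : SymExt := by
  sorry

/-- **STUB 3 `stub_uniformGeometry` — UNIFORM GEOMETRY (the load-bearing open piece).** A smooth homotopy 4-sphere
admitting self-diffeomorphisms of unboundedly many prime orders admits ONE extrinsic geometry class `(N, τ, R)`,
`0 < τ`, in which, for unboundedly many primes `p`, it embeds smoothly into `B_R ⊂ ℝ^N` with reach `≥ τ`
invariantly under a linear isometry inducing order exactly `p` on the image (verbatim the inner hypothesis of the
route support `LargeSymmetryStandard`). True on the standard `S⁴` (rotations of `S⁴ ⊂ ℝ⁵`); open for a putative
exotic `Σ` (why it might fail: symmetries for infinitely many `p` only with distortion `R/τ → ∞`; Mundet i Riera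
2024, Thm 1.7, exotic tori). First lemma: Mostow–Palais equivariant embedding of each `(M, f_p)`.
[MundetRiera2024] [Palais1970] [Federer1959] -/
theorem stub_uniformGeometry :
    ∀ (M : Type) [TopologicalSpace M] [T2Space M] [SecondCountableTopology M]
      [ChartedSpace (EuclideanSpace ℝ (Fin 4)) M] [IsManifold (𝓡 4) ∞ M],
      Nonempty (M ≃ₕ Metric.sphere (0 : EuclideanSpace ℝ (Fin 5)) 1) →
      (∀ n : ℕ, ∃ (p : ℕ) (f : M ≃ₘ⟮𝓡 4, 𝓡 4⟯ M), n ≤ p ∧ p.Prime ∧ (⇑f)^[p] = id ∧ ⇑f ≠ id) →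
      ∃ (N : ℕ) (τ R : ℝ), 0 < τ ∧ ∀ n : ℕ, ∃ (p : ℕ) (e : M → EuclideanSpace ℝ (Fin N))
        (A : EuclideanSpace ℝ (Fin N) ≃ₗᵢ[ℝ] EuclideanSpace ℝ (Fin N)),
        n ≤ p ∧ p.Prime ∧ Manifold.IsSmoothEmbedding (𝓡 4) 𝓘(ℝ, EuclideanSpace ℝ (Fin N)) ∞ e ∧
        (∀ x, ‖e x‖ ≤ R) ∧
        (∀ y : EuclideanSpace ℝ (Fin N), Metric.infDist y (Set.range e) < τ →
          ∃! z, z ∈ Set.range e ∧ dist y z = Metric.infDist y (Set.range e)) ∧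
        ⇑A '' Set.range e = Set.range e ∧ (∀ x, (⇑A)^[p] (e x) = e x) ∧ (∃ x, A (e x) ≠ e x) := by
  sorry

/-! ## Composition: stubs ⟹ crux (no `sorry` below this line) -/

/-- **The engine split of `SymInfty`, arrow form**: Fintushel–Pao (STUB 1) + the extrinsic symmetry-extension
engine (STUB 2) + uniform geometry (STUB 3) give the statement of the crux `CyclicSymmetryRung.SymInfty`, unfolded
(so that this arrow theorem is not itself a by-name candidate for the skeleton audit; the by-name theorem is
`SymInfty_of` below). Proof: STUB 3 gives `(N, τ, R)`; STUB 2 gives `p₀`; STUB 3 at `p₀` gives a prime `p ≥ p₀`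
realised linearly in that class; `M` is compact (`compactSpace_of_homotopyEquiv_sphere_four_holds`, Hatcher
Prop. 3.29); STUB 2 yields a smooth effective circle action; STUB 1 the diffeomorphism. [folklore] -/
theorem symInfty_of_stubs
    (hFP : FintushelPao) (hSE : SymExt)
    (hUG : ∀ (M : Type) [TopologicalSpace M] [T2Space M] [SecondCountableTopology M]
      [ChartedSpace (EuclideanSpace ℝ (Fin 4)) M] [IsManifold (𝓡 4) ∞ M],
      Nonempty (M ≃ₕ Metric.sphere (0 : EuclideanSpace ℝ (Fin 5)) 1) →
      (∀ n : ℕ, ∃ (p : ℕ) (f : M ≃ₘ⟮𝓡 4, 𝓡 4⟯ M), n ≤ p ∧ p.Prime ∧ (⇑f)^[p] = id ∧ ⇑f ≠ id) →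
      ∃ (N : ℕ) (τ R : ℝ), 0 < τ ∧ ∀ n : ℕ, ∃ (p : ℕ) (e : M → EuclideanSpace ℝ (Fin N))
        (A : EuclideanSpace ℝ (Fin N) ≃ₗᵢ[ℝ] EuclideanSpace ℝ (Fin N)),
        n ≤ p ∧ p.Prime ∧ Manifold.IsSmoothEmbedding (𝓡 4) 𝓘(ℝ, EuclideanSpace ℝ (Fin N)) ∞ e ∧
        (∀ x, ‖e x‖ ≤ R) ∧
        (∀ y : EuclideanSpace ℝ (Fin N), Metric.infDist y (Set.range e) < τ →
          ∃! z, z ∈ Set.range e ∧ dist y z = Metric.infDist y (Set.range e)) ∧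
        ⇑A '' Set.range e = Set.range e ∧ (∀ x, (⇑A)^[p] (e x) = e x) ∧ (∃ x, A (e x) ≠ e x)) :
    ∀ (M : Type) [TopologicalSpace M] [T2Space M] [SecondCountableTopology M]
      [ChartedSpace (EuclideanSpace ℝ (Fin 4)) M] [IsManifold (𝓡 4) ∞ M],
      Nonempty (M ≃ₕ Metric.sphere (0 : EuclideanSpace ℝ (Fin 5)) 1) →
      (∀ n : ℕ, ∃ (p : ℕ) (f : M ≃ₘ⟮𝓡 4, 𝓡 4⟯ M), n ≤ p ∧ p.Prime ∧ (⇑f)^[p] = id ∧ ⇑f ≠ id) →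
      Nonempty (M ≃ₘ⟮𝓡 4, 𝓡 4⟯ Metric.sphere (0 : EuclideanSpace ℝ (Fin 5)) 1) := by
  intro M _ _ _ _ _ hM hsym
  obtain ⟨N, τ, R, hτ, h⟩ := hUG M hM hsym
  obtain ⟨p₀, hp₀⟩ := hSE N τ R hτ
  obtain ⟨p, e, A, hp, hprime, hemb, hR, hreach, hinv, hper, hne⟩ := h p₀
  obtain ⟨φ⟩ := hM
  haveI : CompactSpace M :=
    Literature.Topology.FourManifolds.compactSpace_of_homotopyEquiv_sphere_four_holds M φ
  obtain ⟨inst, hfaith, hsmooth⟩ := hp₀ M e A p ⟨φ⟩ hprime hp hemb hR hreach hinv hper hne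
  letI : MulAction Circle M := inst
  exact hFP M hfaith hsmooth ⟨φ⟩

/-- **`SymInfty_of` — THE SKELETON**: the crux `CyclicSymmetryRung.SymInfty` BY NAME, closed modulo the three
registered stubs (D-0027 §3.3 shape `<Crux>_proof := crux_of stub₁_holds stub₂_holds stub₃_holds`). Becomes the
crux proof when the stubs are discharged (STUB 1, STUB 2 by the route items' `_holds` theorems). -/
theorem SymInfty_of :
    Summit.SmoothPoincare4.SmoothPoincare4.Theses.CyclicSymmetryRung.SymInfty :=
  symInfty_of_stubs stub_fintushelPao stub_symExt stub_uniformGeometry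

/-- BC3 letter: `<stub₁-sig> → <stub₂-sig> → <stub₃-sig> → SymInfty` with the crux BY NAME (an `example`, so
that `SymInfty_of` stays the only by-name candidate the skeleton audit sees). -/
example :
    FintushelPao → SymExt →
    (∀ (M : Type) [TopologicalSpace M] [T2Space M] [SecondCountableTopology M]
      [ChartedSpace (EuclideanSpace ℝ (Fin 4)) M] [IsManifold (𝓡 4) ∞ M],
      Nonempty (M ≃ₕ Metric.sphere (0 : EuclideanSpace ℝ (Fin 5)) 1) →
      (∀ n : ℕ, ∃ (p : ℕ) (f : M ≃ₘ⟮𝓡 4, 𝓡 4⟯ M), n ≤ p ∧ p.Prime ∧ (⇑f)^[p] = id ∧ ⇑f ≠ id) →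
      ∃ (N : ℕ) (τ R : ℝ), 0 < τ ∧ ∀ n : ℕ, ∃ (p : ℕ) (e : M → EuclideanSpace ℝ (Fin N))
        (A : EuclideanSpace ℝ (Fin N) ≃ₗᵢ[ℝ] EuclideanSpace ℝ (Fin N)),
        n ≤ p ∧ p.Prime ∧ Manifold.IsSmoothEmbedding (𝓡 4) 𝓘(ℝ, EuclideanSpace ℝ (Fin N)) ∞ e ∧
        (∀ x, ‖e x‖ ≤ R) ∧
        (∀ y : EuclideanSpace ℝ (Fin N), Metric.infDist y (Set.range e) < τ →
          ∃! z, z ∈ Set.range e ∧ dist y z = Metric.infDist y (Set.range e)) ∧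
        ⇑A '' Set.range e = Set.range e ∧ (∀ x, (⇑A)^[p] (e x) = e x) ∧ (∃ x, A (e x) ≠ e x)) →
    Summit.SmoothPoincare4.SmoothPoincare4.Theses.CyclicSymmetryRung.SymInfty :=
  symInfty_of_stubs

end Summit.SmoothPoincare4.SmoothPoincare4.Cruxes.SymInfty.Birth
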